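import Summits.AtomisticToContinuum.HydrodynamicLimit.Theorems.CollisionIsometryCLTCollisionalTransferLocalityCompressibilityBound
import Summits.AtomisticToContinuum.HydrodynamicLimit.Theorems.CollisionIsometryCLTCollisionalTransferLocalityBlockFields
import HarnessLib

/-!
# `(Z−1)`-weighted weak kinetic relaxation [C] (registered stub `stub_weightedKineticRelaxation`)

Stub [C] of the line `hemisphere-affine-slaving` for the crux `CollisionalTransferLocality`
(stmt-AtomisticToContinuum-9518): Ruelle convexity (`HsFreeEnergyConvex`), the kinetic closure
`FMRAt` (conclusion of 9522: `∫₀ᵗ∫ ΣD² + |q|² → 0` in probability), the exponential velocity moments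
`ExpMomAt` and the density window `WindowAt` (9519 (i)/(ii)) imply `RelaxC`: uniformly in `τ ≤ t`,
`K_N(z, τ) = ∫₀^τ∫ kinW · p_c(ρ̄, θ̄) = ∫₀^τ∫ (Z(ρ̄σ³) − 1)[(2/5)(D:∇ψ + Dū·∇χ) + (3/5) q·∇χ] → 0`
in local-Gibbs probability — the only Maxwellian content of the crux. Proof (the card's "ten-line
Cauchy–Schwarz glue"): `kinW · p_c = [(2/5)(S₁+S₂) + (3/5)S₃](Z − 1)` off `ρ̄θ̄ = 0` and `0` on it;
`|Z − 1| ≤ C_Z` on the window (file `…CompressibilityBound`); termwise AM–GM with a free `ε` and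
`|ū|² ≤ 2Ē/ρ̄ ≤ 2Ē/c₁` give `|kinW·p_c| ≤ C_Z C_t (12ε + 24ε Ē/c₁ + 21 ε⁻¹ (ΣD² + |q|²))`;
`∫ₓ Ē = (N+1)⁻¹ E_kin` is conserved along good orbits and `2λ t (N+1)⁻¹E_kin ≤ ∫₀ᵗ∫ exp(λ|v|²)`; all
dominating functions are honest integrals (file `…BlockFields`); choosing `ε`, then the `FMRAt`
level `δ'`, from `δ` gives `sup_τ |K_N| ≤ 2δ/3` on the good set (conull) off the three bad events;
union bound and squeeze. Sources: Chapman–Cowling 1970 §16.4; Spohn 1991 I §3.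
-/
namespace Summit.AtomisticToContinuum.HydrodynamicLimit.Theorems.HemisphereAffineSlaving

open scoped BigOperators Topology Classical MeasureTheory ENNReal
open Filter Set Function TopologicalSpace MeasureTheory

noncomputable section

open Literature.MathematicalPhysics.KineticTheory (T3 V3 hsCompressibility hsPressure localGibbsLaw)
open Literature.Analysis.FluidPDE (empiricalMeasure integral_empiricalMeasure configEnergy)

variable {N : ℕ}

/-! ## (CS) The pointwise bound on the integrand of `K_N` -/

/-- KEY ALGEBRA: `kinW · p_c = [(2/5)(S₁ + S₂) + (3/5) S₃](Z − 1)` off `pkin = 0` and `0` on it, so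
`|kinW · p_c| ≤ (|S₁| + |S₂| + |S₃|)|Z(ρ̄σ³) − 1|`. [folklore] -/
theorem abs_kinW_mul_pcoll_le (ψ : ℝ → T3 → V3) (χ : ℝ → T3 → ℝ) (φ : ℕ → T3 → ℝ) (s : ℝ)
    (w : Cfg N) (x : T3) (σ : ℝ) :
    |kinW ψ χ φ N s w x * pcoll σ (rhoB φ N w x) (thetaB φ N w x)| ≤
      (|∑ a, ∑ b, Dst φ N w x a b * gradPsi ψ s x a b| +
        |∑ a, ∑ b, Dst φ N w x a b * uB φ N w x b * gradChi χ s x a| +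
        |∑ a, qfl φ N w x a * gradChi χ s x a|) *
      |hsCompressibility (rhoB φ N w x * σ ^ 3) - 1| := by
  unfold kinW pcoll hsPressure
  have hP : rhoB φ N w x * thetaB φ N w x = pkin φ N w x := rfl
  rw [hP]
  set P := pkin φ N w x
  set S₁ := ∑ a, ∑ b, Dst φ N w x a b * gradPsi ψ s x a b
  set S₂ := ∑ a, ∑ b, Dst φ N w x a b * uB φ N w x b * gradChi χ s x a
  set S₃ := ∑ a, qfl φ N w x a * gradChi χ s x a
  set Z := hsCompressibility (rhoB φ N w x * σ ^ 3)
  by_cases h0 : P = 0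
  · simp only [h0, div_zero, add_zero, zero_mul, abs_zero]
    positivity
  · have : (2 / 5 * (S₁ + S₂) / P + 3 / 5 * S₃ / P) * (P * Z - P) =
        (2 / 5 * (S₁ + S₂) + 3 / 5 * S₃) * (Z - 1) := by
      field_simp
    rw [this, abs_mul]
    gcongr
    calc |2 / 5 * (S₁ + S₂) + 3 / 5 * S₃| ≤ |2 / 5 * (S₁ + S₂)| + |3 / 5 * S₃| := abs_add_le _ _
      _ = 2 / 5 * |S₁ + S₂| + 3 / 5 * |S₃| := by
          rw [abs_mul, abs_mul, abs_of_pos (by norm_num : (0 : ℝ) < 2 / 5),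
            abs_of_pos (by norm_num : (0 : ℝ) < 3 / 5)]
      _ ≤ 2 / 5 * (|S₁| + |S₂|) + 3 / 5 * |S₃| := by gcongr; exact abs_add_le _ _
      _ ≤ |S₁| + |S₂| + |S₃| := by
          linarith [abs_nonneg S₁, abs_nonneg S₂, abs_nonneg S₃]

/-- **(CS) pointwise.** On a block of the window, for test gradients `≤ C_t` and every `ε > 0`:
`|kinW · p_c| ≤ C_Z C_t (12 ε + 24 ε Ē/c₁ + 21 ε⁻¹ (ΣD² + |q|²))` (AM–GM, `|ū|² ≤ 2Ē/ρ̄`).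
[folklore] -/
theorem abs_integrand_le {ψ : ℝ → T3 → V3} {χ : ℝ → T3 → ℝ} {φ : ℕ → T3 → ℝ} {s : ℝ}
    {w : Cfg N} {x : T3} {σ c₁ CZ Ct ε : ℝ} (hφ0 : ∀ y, 0 ≤ φ N y) (hc₁ : 0 < c₁) (hε : 0 < ε)
    (hCt : 0 ≤ Ct) (hZ : ∀ r : ℝ, c₁ ≤ r → r * σ ^ 3 ≤ 1 → |hsCompressibility (r * σ ^ 3) - 1| ≤ CZ)
    (hψ : ∀ a b, |gradPsi ψ s x a b| ≤ Ct) (hχ : ∀ a, |gradChi χ s x a| ≤ Ct)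
    (hlo : c₁ ≤ rhoB φ N w x) (hhi : rhoB φ N w x * σ ^ 3 ≤ 1) :
    |kinW ψ χ φ N s w x * pcoll σ (rhoB φ N w x) (thetaB φ N w x)| ≤
      CZ * Ct * (12 * ε) + CZ * Ct * (24 * ε / c₁) * EB φ N w x +
        CZ * Ct * (21 / ε) * ((∑ j, ∑ k, Dst φ N w x j k ^ 2) + ‖qfl φ N w x‖ ^ 2) := by
  have hCZ : |hsCompressibility (rhoB φ N w x * σ ^ 3) - 1| ≤ CZ := hZ _ hlo hhi
  have hCZ0 : 0 ≤ CZ := (abs_nonneg _).trans hCZ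
  set Pf := ((∑ j, ∑ k, Dst φ N w x j k ^ 2) + ‖qfl φ N w x‖ ^ 2) with hPf
  have hP0 : 0 ≤ Pf := by positivity
  have hDsq : ∀ a b, Dst φ N w x a b ^ 2 ≤ Pf := fun a b => by
    calc Dst φ N w x a b ^ 2 ≤ ∑ k, Dst φ N w x a k ^ 2 :=
          Finset.single_le_sum (f := fun k => Dst φ N w x a k ^ 2) (fun k _ => sq_nonneg _)
            (Finset.mem_univ b)
      _ ≤ ∑ j, ∑ k, Dst φ N w x j k ^ 2 :=
          Finset.single_le_sum (f := fun j => ∑ k, Dst φ N w x j k ^ 2)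
            (fun j _ => Finset.sum_nonneg fun k _ => sq_nonneg _) (Finset.mem_univ a)
      _ ≤ Pf := le_add_of_nonneg_right (sq_nonneg _)
  have hqsq : ∀ a, qfl φ N w x a ^ 2 ≤ Pf := fun a => (sq_apply_le_norm_sq _ a).trans
    (le_add_of_nonneg_left (by positivity))
  have hρ : 0 < rhoB φ N w x := lt_of_lt_of_le hc₁ hlo
  have hu2 : ‖uB φ N w x‖ ^ 2 ≤ 2 * EB φ N w x / c₁ :=
    (norm_uB_sq_le hφ0 hρ).trans (div_le_div_of_nonneg_left
      (mul_nonneg zero_le_two (EB_nonneg hφ0)) hc₁ hlo)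
  -- the three sums
  have h1 : |∑ a, ∑ b, Dst φ N w x a b * gradPsi ψ s x a b| ≤ 9 * ((ε + Pf / ε) * Ct) := by
    calc |∑ a, ∑ b, Dst φ N w x a b * gradPsi ψ s x a b|
        ≤ ∑ a, ∑ b, |Dst φ N w x a b * gradPsi ψ s x a b| :=
          (Finset.abs_sum_le_sum_abs _ _).trans (Finset.sum_le_sum fun a _ =>
            Finset.abs_sum_le_sum_abs _ _)
      _ ≤ ∑ _a : Fin 3, ∑ _b : Fin 3, (ε + Pf / ε) * Ct := by
          refine Finset.sum_le_sum fun a _ => Finset.sum_le_sum fun b _ => ?_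
          rw [abs_mul]
          exact mul_le_mul (abs_le_eps hε (hDsq a b)) (hψ a b) (abs_nonneg _) (by positivity)
      _ = 9 * ((ε + Pf / ε) * Ct) := by simp [Finset.sum_const]; ring
  have h2 : |∑ a, ∑ b, Dst φ N w x a b * uB φ N w x b * gradChi χ s x a| ≤
      9 * ((Pf / ε + ε * ‖uB φ N w x‖ ^ 2) * Ct) := by
    calc |∑ a, ∑ b, Dst φ N w x a b * uB φ N w x b * gradChi χ s x a|
        ≤ ∑ a, ∑ b, |Dst φ N w x a b * uB φ N w x b * gradChi χ s x a| :=
          (Finset.abs_sum_le_sum_abs _ _).trans (Finset.sum_le_sum fun a _ =>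
            Finset.abs_sum_le_sum_abs _ _)
      _ ≤ ∑ _a : Fin 3, ∑ _b : Fin 3, (Pf / ε + ε * ‖uB φ N w x‖ ^ 2) * Ct := by
          refine Finset.sum_le_sum fun a _ => Finset.sum_le_sum fun b _ => ?_
          rw [abs_mul, abs_mul]
          refine mul_le_mul ((abs_mul_abs_le_eps hε (hDsq a b)).trans ?_) (hχ a) (abs_nonneg _)
            (by positivity)
          exact add_le_add le_rfl (mul_le_mul_of_nonneg_left (sq_apply_le_norm_sq _ b) hε.le)
      _ = 9 * ((Pf / ε + ε * ‖uB φ N w x‖ ^ 2) * Ct) := by simp [Finset.sum_const]; ring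
  have h3 : |∑ a, qfl φ N w x a * gradChi χ s x a| ≤ 3 * ((ε + Pf / ε) * Ct) := by
    calc |∑ a, qfl φ N w x a * gradChi χ s x a| ≤ ∑ a, |qfl φ N w x a * gradChi χ s x a| :=
          Finset.abs_sum_le_sum_abs _ _
      _ ≤ ∑ _a : Fin 3, (ε + Pf / ε) * Ct := by
          refine Finset.sum_le_sum fun a _ => ?_
          rw [abs_mul]
          exact mul_le_mul (abs_le_eps hε (hqsq a)) (hχ a) (abs_nonneg _) (by positivity)
      _ = 3 * ((ε + Pf / ε) * Ct) := by simp [Finset.sum_const]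
  refine (abs_kinW_mul_pcoll_le ψ χ φ s w x σ).trans ?_
  calc (|∑ a, ∑ b, Dst φ N w x a b * gradPsi ψ s x a b| +
        |∑ a, ∑ b, Dst φ N w x a b * uB φ N w x b * gradChi χ s x a| +
        |∑ a, qfl φ N w x a * gradChi χ s x a|) * |hsCompressibility (rhoB φ N w x * σ ^ 3) - 1|
      ≤ (9 * ((ε + Pf / ε) * Ct) + 9 * ((Pf / ε + ε * ‖uB φ N w x‖ ^ 2) * Ct) +
          3 * ((ε + Pf / ε) * Ct)) * CZ := by gcongr
    _ ≤ (9 * ((ε + Pf / ε) * Ct) + 9 * ((Pf / ε + ε * (2 * EB φ N w x / c₁)) * Ct) +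
          3 * ((ε + Pf / ε) * Ct)) * CZ := by gcongr
    _ ≤ CZ * Ct * (12 * ε * (1 + 2 * EB φ N w x / c₁) + 21 * (Pf / ε)) := by
        have hE : 0 ≤ 2 * EB φ N w x / c₁ :=
          div_nonneg (mul_nonneg zero_le_two (EB_nonneg hφ0)) hc₁.le
        have hPe : 0 ≤ Pf / ε := div_nonneg hP0 hε.le
        nlinarith [mul_nonneg hCZ0 hCt, mul_nonneg (mul_nonneg hCZ0 hCt) hE,
          mul_nonneg (mul_nonneg hCZ0 hCt) hε.le]
    _ = _ := by rw [hPf]; ring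

/-! ## Integration in `x` and in `s`; the exponential-moment energy bound -/

/-- `x`-integration of the pointwise bound: `‖∫ₓ kinW·p_c‖ ≤ A + B (N+1)⁻¹E_kin + C ∫ₓ(ΣD² + |q|²)`
(honest dominating integrand: `Ē` continuous, `ΣD² + |q|²` measurable and bounded). [folklore] -/
theorem norm_integral_integrand_le {ψ : ℝ → T3 → V3} {χ : ℝ → T3 → ℝ} {φ : ℕ → T3 → ℝ} {s : ℝ}
    {w : Cfg N} {σ c₁ CZ Ct ε Φb : ℝ} (hφc : Continuous (φ N)) (hφ0 : ∀ y, 0 ≤ φ N y)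
    (hφ1 : ∫ y, φ N y = 1) (hφb : ∀ y, φ N y ≤ Φb) (hc₁ : 0 < c₁) (hε : 0 < ε) (hCt : 0 ≤ Ct)
    (hZ : ∀ r : ℝ, c₁ ≤ r → r * σ ^ 3 ≤ 1 → |hsCompressibility (r * σ ^ 3) - 1| ≤ CZ)
    (hψ : ∀ x a b, |gradPsi ψ s x a b| ≤ Ct) (hχ : ∀ x a, |gradChi χ s x a| ≤ Ct)
    (hwin : ∀ x, c₁ ≤ rhoB φ N w x ∧ rhoB φ N w x * σ ^ 3 ≤ 1) :
    ‖∫ x, kinW ψ χ φ N s w x * pcoll σ (rhoB φ N w x) (thetaB φ N w x)‖ ≤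
      CZ * Ct * (12 * ε) + CZ * Ct * (24 * ε / c₁) * (((N + 1 : ℕ) : ℝ)⁻¹ * configEnergy w) +
        CZ * Ct * (21 / ε) * ∫ x, ((∑ j, ∑ k, Dst φ N w x j k ^ 2) + ‖qfl φ N w x‖ ^ 2) := by
  set Vb : ℝ := ∑ i, ‖(w i).2‖ with hVb_def
  have hVb : 0 ≤ Vb := Finset.sum_nonneg fun i _ => norm_nonneg _
  have hV : ∀ i, ‖(w i).2‖ ≤ Vb := fun i =>
    Finset.single_le_sum (f := fun i => ‖(w i).2‖) (fun i _ => norm_nonneg _) (Finset.mem_univ i)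
  have hPint : Integrable (fun x => ((∑ j, ∑ k, Dst φ N w x j k ^ 2) + ‖qfl φ N w x‖ ^ 2)) := by
    refine Integrable.mono' (integrable_const (9 * (8 * Φb * Vb ^ 2) ^ 2 + (4 * Φb * Vb ^ 3) ^ 2))
      ((measurable_kineticIntegrand φ N hφc).comp
        (measurable_const.prodMk measurable_id)).aestronglyMeasurable
      (ae_of_all _ fun x => ?_)
    rw [Real.norm_eq_abs, abs_of_nonneg (by positivity)]
    exact kineticIntegrand_le hφ0 hφb hVb hV
  have hEint : Integrable (fun x => EB φ N w x) :=
    ((continuous_EB hφc).comp (continuous_const.prodMk continuous_id)).integrable_unitAddTorus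
  have hgi : Integrable (fun x => CZ * Ct * (12 * ε) + CZ * Ct * (24 * ε / c₁) * EB φ N w x +
      CZ * Ct * (21 / ε) * ((∑ j, ∑ k, Dst φ N w x j k ^ 2) + ‖qfl φ N w x‖ ^ 2)) :=
    ((integrable_const _).add (hEint.const_mul _)).add (hPint.const_mul _)
  refine (norm_integral_le_of_norm_le hgi (ae_of_all _ fun x => ?_)).trans (le_of_eq ?_)
  · rw [Real.norm_eq_abs]
    exact abs_integrand_le hφ0 hc₁ hε hCt hZ (hψ x) (hχ x) (hwin x).1 (hwin x).2
  · have hi1 : Integrable (fun x => CZ * Ct * (12 * ε) + CZ * Ct * (24 * ε / c₁) * EB φ N w x) :=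
      (integrable_const _).add (hEint.const_mul _)
    rw [integral_add hi1 (hPint.const_mul _), integral_add (integrable_const _) (hEint.const_mul _),
      integral_const, integral_const_mul, integral_const_mul, integral_EB hφc hφ1]
    simp

section Orbit2

variable {σ : ℝ} (Φ : Flows σ) {z : Cfg N} (hz : z ∈ (Φ N).good)
include hz

/-- **Energy from the exponential moment** on a good orbit: `λ|v|² ≤ exp(λ|v|²)` and energy
conservation give `2λ t (N+1)⁻¹ E_kin(z) ≤ ∫₀ᵗ ∫ exp(λ|v|²) dμ_{Φ_s z} ds` (honest integral).
[folklore] -/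
theorem energy_le_expMoment {lam t : ℝ} (hlam : 0 < lam) (ht : 0 ≤ t) :
    2 * lam * (((N + 1 : ℕ) : ℝ)⁻¹ * configEnergy z) * t ≤
      ∫ s in Icc 0 t, ∫ y, Real.exp (lam * ‖y.2‖ ^ 2) ∂(empiricalMeasure ((Φ N).flow s z)) := by
  haveI : ∀ i : Fin (N + 1), BorelSpace (T3 × V3) := fun _ => Prod.borelSpace
  set n : ℝ := ((N + 1 : ℕ) : ℝ)⁻¹ with hn
  have hn0 : 0 ≤ n := by positivity
  have hE0 : 0 ≤ configEnergy z := by unfold configEnergy; positivity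
  set g : ℝ → ℝ := fun s => ∫ y, Real.exp (lam * ‖y.2‖ ^ 2) ∂(empiricalMeasure ((Φ N).flow s z))
    with hg
  have hg_eq : ∀ s, g s = n * ∑ i, Real.exp (lam * ‖((Φ N).flow s z i).2‖ ^ 2) := fun s =>
    integral_empiricalMeasure _ _
  have hv2 : ∀ s i, ‖((Φ N).flow s z i).2‖ ^ 2 ≤ 2 * configEnergy z := fun s i => by
    calc ‖((Φ N).flow s z i).2‖ ^ 2 ≤ Real.sqrt (2 * configEnergy z) ^ 2 :=
          pow_le_pow_left₀ (norm_nonneg _) (norm_vel_orbit_le Φ hz s i) 2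
      _ = 2 * configEnergy z := Real.sq_sqrt (by positivity)
  have hlow : ∀ s, 2 * lam * (n * configEnergy z) ≤ g s := fun s => by
    rw [hg_eq, ← configEnergy_orbit Φ hz s, configEnergy]
    calc 2 * lam * (n * (2⁻¹ * ∑ i, ‖((Φ N).flow s z i).2‖ ^ 2))
        = n * (lam * ∑ i, ‖((Φ N).flow s z i).2‖ ^ 2) := by ring
      _ = n * ∑ i, lam * ‖((Φ N).flow s z i).2‖ ^ 2 := by rw [Finset.mul_sum]
      _ ≤ n * ∑ i, Real.exp (lam * ‖((Φ N).flow s z i).2‖ ^ 2) :=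
          mul_le_mul_of_nonneg_left (Finset.sum_le_sum fun i _ =>
            (le_add_of_nonneg_right zero_le_one).trans (Real.add_one_le_exp _)) hn0
  have hup : ∀ s, g s ≤ Real.exp (lam * (2 * configEnergy z)) := fun s => by
    rw [hg_eq]
    calc n * ∑ i, Real.exp (lam * ‖((Φ N).flow s z i).2‖ ^ 2)
        ≤ n * ∑ _i : Fin (N + 1), Real.exp (lam * (2 * configEnergy z)) :=
          mul_le_mul_of_nonneg_left (Finset.sum_le_sum fun i _ =>
            Real.exp_le_exp.2 (mul_le_mul_of_nonneg_left (hv2 s i) hlam.le)) hn0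
      _ = Real.exp (lam * (2 * configEnergy z)) := by
          rw [Finset.sum_const, Finset.card_univ, Fintype.card_fin, nsmul_eq_mul, ← mul_assoc, hn,
            inv_mul_cancel₀ (by positivity), one_mul]
  have hg0 : ∀ s, 0 ≤ g s := fun s => le_trans (by positivity) (hlow s)
  have hgm : Measurable g := by
    have : g = (fun w : Cfg N => n * ∑ i, Real.exp (lam * ‖(w i).2‖ ^ 2)) ∘
        fun s => (Φ N).flow s z :=
      funext fun s => hg_eq s
    rw [this]
    exact (Continuous.measurable (by fun_prop)).comp (measurable_orbit Φ hz)
  have hgi : IntegrableOn g (Icc 0 t) :=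
    Measure.integrableOn_of_bounded measure_Icc_lt_top.ne hgm.aestronglyMeasurable
      (ae_of_all _ fun s => by rw [Real.norm_eq_abs, abs_of_nonneg (hg0 s)]; exact hup s)
  have h1 : ∫ _ in Icc 0 t, 2 * lam * (n * configEnergy z) ≤ ∫ s in Icc 0 t, g s :=
    setIntegral_mono (integrableOn_const (measure_Icc_lt_top.ne)) hgi hlow
  rw [setIntegral_const] at h1
  simpa [Measure.real, Real.volume_Icc, ht, mul_comm] using h1

/-- **The pathwise bound on `K_N`** on a good orbit inside the window on `[0, t]`, test gradients
`≤ C_t`, `|Z − 1| ≤ C_Z` on the window, `ε > 0`, `τ ≤ t`: `|K_N(z, τ)| ≤ (A + B (N+1)⁻¹E_kin(z)) t +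
C ∫₀ᵗ∫ₓ (ΣD² + |q|²)`, `A = 12 C_Z C_t ε`, `B = 24 C_Z C_t ε/c₁`, `C = 21 C_Z C_t/ε`. [folklore] -/
theorem abs_Kfun_le {ψ : ℝ → T3 → V3} {χ : ℝ → T3 → ℝ} {φ : ℕ → T3 → ℝ} {t c₁ CZ Ct ε Φb : ℝ}
    (hφc : Continuous (φ N)) (hφ0 : ∀ y, 0 ≤ φ N y) (hφ1 : ∫ y, φ N y = 1)
    (hφb : ∀ y, φ N y ≤ Φb) (hc₁ : 0 < c₁) (hε : 0 < ε) (hCt : 0 ≤ Ct) (hCZ : 0 ≤ CZ)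
    (hZ : ∀ r : ℝ, c₁ ≤ r → r * σ ^ 3 ≤ 1 → |hsCompressibility (r * σ ^ 3) - 1| ≤ CZ)
    (hψ : ∀ s ∈ Icc 0 t, ∀ x a b, |gradPsi ψ s x a b| ≤ Ct)
    (hχ : ∀ s ∈ Icc 0 t, ∀ x a, |gradChi χ s x a| ≤ Ct)
    (hwin : ∀ s ∈ Icc 0 t, ∀ x, c₁ ≤ rhoB φ N ((Φ N).flow s z) x ∧
      rhoB φ N ((Φ N).flow s z) x * σ ^ 3 ≤ 1) {τ : ℝ} (hτ : τ ∈ Icc 0 t) :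
    |Kfun σ Φ φ ψ χ N z τ| ≤
      (CZ * Ct * (12 * ε) + CZ * Ct * (24 * ε / c₁) * (((N + 1 : ℕ) : ℝ)⁻¹ * configEnergy z)) * t +
        CZ * Ct * (21 / ε) *
          ∫ s in Icc 0 t, ∫ x, ((∑ j, ∑ k, Dst φ N ((Φ N).flow s z) x j k ^ 2) +
            ‖qfl φ N ((Φ N).flow s z) x‖ ^ 2) := by
  set A := CZ * Ct * (12 * ε) + CZ * Ct * (24 * ε / c₁) * (((N + 1 : ℕ) : ℝ)⁻¹ * configEnergy z)
    with hA
  set Cc := CZ * Ct * (21 / ε) with hCc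
  set G : ℝ → ℝ := fun s =>
    ∫ x, ((∑ j, ∑ k, Dst φ N ((Φ N).flow s z) x j k ^ 2) + ‖qfl φ N ((Φ N).flow s z) x‖ ^ 2) with hG
  have hE0 : 0 ≤ configEnergy z := by unfold configEnergy; positivity
  have hA0 : 0 ≤ A := by positivity
  have hCc0 : 0 ≤ Cc := by positivity
  have hVb : 0 ≤ Real.sqrt (2 * configEnergy z) := Real.sqrt_nonneg _
  have hG0 : ∀ s, 0 ≤ G s := fun s => integral_nonneg fun x => by positivity
  have hGm : Measurable G := by
    have hg : Measurable fun q : ℝ × T3 => (((Φ N).flow q.1 z, q.2) : Cfg N × T3) :=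
      ((measurable_orbit Φ hz).comp measurable_fst).prodMk measurable_snd
    have hj : Measurable ((fun p : Cfg N × T3 =>
        ((∑ j, ∑ k, Dst φ N p.1 p.2 j k ^ 2) + ‖qfl φ N p.1 p.2‖ ^ 2)) ∘
        fun q : ℝ × T3 => (((Φ N).flow q.1 z, q.2) : Cfg N × T3)) :=
      (measurable_kineticIntegrand φ N hφc).comp hg
    exact hj.stronglyMeasurable.integral_prod_right'.measurable
  set M : ℝ := 9 * (8 * Φb * Real.sqrt (2 * configEnergy z) ^ 2) ^ 2 +
    (4 * Φb * Real.sqrt (2 * configEnergy z) ^ 3) ^ 2 with hM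
  have hGb : ∀ s, ‖G s‖ ≤ M := fun s => by
    refine (norm_integral_le_of_norm_le (integrable_const M) (ae_of_all _ fun x => ?_)).trans ?_
    · rw [Real.norm_eq_abs, abs_of_nonneg (by positivity)]
      exact kineticIntegrand_le hφ0 hφb hVb (norm_vel_orbit_le Φ hz s)
    · simp
  have hGi : IntegrableOn G (Icc 0 t) :=
    Measure.integrableOn_of_bounded measure_Icc_lt_top.ne hGm.aestronglyMeasurable (ae_of_all _ hGb)
  have hBi : IntegrableOn (fun s => A + Cc * G s) (Icc 0 t) :=
    (integrableOn_const measure_Icc_lt_top.ne).add (hGi.const_mul Cc)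
  have ht0 : 0 ≤ t := hτ.1.trans hτ.2
  unfold Kfun
  rw [← Real.norm_eq_abs]
  calc ‖∫ s in Icc 0 τ, ∫ x, kinW ψ χ φ N s ((Φ N).flow s z) x *
        pcoll σ (rhoB φ N ((Φ N).flow s z) x) (thetaB φ N ((Φ N).flow s z) x)‖
      ≤ ∫ s in Icc 0 τ, (A + Cc * G s) := by
        refine norm_integral_le_of_norm_le (hBi.mono_set (Icc_subset_Icc_right hτ.2))
          (ae_restrict_of_forall_mem measurableSet_Icc fun s hs => ?_)
        have hs' : s ∈ Icc 0 t := ⟨hs.1, hs.2.trans hτ.2⟩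
        have h := norm_integral_integrand_le hφc hφ0 hφ1 hφb hc₁ hε hCt hZ (hψ s hs') (hχ s hs')
          (hwin s hs') (ψ := ψ) (χ := χ)
        rwa [configEnergy_orbit Φ hz s] at h
    _ ≤ ∫ s in Icc 0 t, (A + Cc * G s) :=
        setIntegral_mono_set hBi (ae_of_all _ fun s => add_nonneg hA0 (mul_nonneg hCc0 (hG0 s)))
          (Icc_subset_Icc_right hτ.2).eventuallyLE
    _ = A * t + Cc * ∫ s in Icc 0 t, G s := by
        have hAi : IntegrableOn (fun _ : ℝ => A) (Icc 0 t) :=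
          integrableOn_const measure_Icc_lt_top.ne
        rw [integral_add hAi (hGi.const_mul Cc), setIntegral_const, integral_const_mul]
        simp [Measure.real, Real.volume_Icc, ht0, mul_comm]

end Orbit2

/-! ## The registered stub -/

/-- **Registered stub `stub_weightedKineticRelaxation`** ([C], the `(Z−1)`-weighted weak kinetic
relaxation) of crux stmt-AtomisticToContinuum-9518 (line hemisphere-affine-slaving): Ruelle
convexity (`HsFreeEnergyConvex`), the kinetic closure `FMRAt` (conclusion of 9522), the time-averaged
exponential velocity moment and the density window (9519 (i)/(ii)) imply `RelaxC`: `K_N(z, τ) → 0`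
in local-Gibbs probability uniformly in `τ ≤ t` (on the good set off the window / moment / `FMRAt`
bad events, `sup_τ |K_N| ≤ 2δ/3` by `abs_Kfun_le` with `ε`, `δ'` chosen from `δ`; union bound).
[folklore] -/
theorem stub_weightedKineticRelaxation :
    Summit.AtomisticToContinuum.HydrodynamicLimit.Theses.StiffCollisionalRelaxation.HsFreeEnergyConvex →
    ∀ (a₀ θ₀ : T3 → ℝ) (u₀ : T3 → V3), NiceProfiles a₀ θ₀ u₀ →
      ∀ σ : ℝ, 0 < σ → FMRAt σ a₀ θ₀ u₀ →
        ∀ (Φ : Flows σ) (t : ℝ), 0 < t → ExpMomAt σ a₀ θ₀ u₀ Φ t →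
          ∀ (γ C : ℝ) (φ : ℕ → T3 → ℝ), 0 < γ → γ ≤ 1 / 15 → AdmissibleKernel γ C φ →
            WindowAt σ a₀ θ₀ u₀ Φ t φ →
            ∀ (ψ : ℝ → T3 → V3) (χ : ℝ → T3 → ℝ),
              Literature.Analysis.FunctionSpaces.Torus.IsSmoothSpaceTimeOn (Icc 0 t) ψ →
              Literature.Analysis.FunctionSpaces.Torus.IsSmoothSpaceTimeOn (Icc 0 t) χ →
              RelaxC σ a₀ θ₀ u₀ Φ φ t ψ χ := by
  intro hH a₀ θ₀ u₀ _ σ hσ hFMR Φ t ht hExp γ C φ hγ hγ' hadm hWin ψ χ hψ hχ δ hδ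
  obtain ⟨lam, Cexp, hlam, hExpT⟩ := hExp
  obtain ⟨c₁, hc₁, hWinT⟩ := hWin
  obtain ⟨CZ, hCZ0, hCZ⟩ := abs_hsCompressibility_sub_one_le hH σ hσ c₁ hc₁
  obtain ⟨Ct, hCt0, hCtψ, hCtχ⟩ := exists_grad_bound ht hψ hχ
  set K : ℝ := CZ * Ct + 1 with hK
  have hK0 : 0 < K := by positivity
  set A₀ : ℝ := 12 * t + 12 * |Cexp| / (c₁ * lam) with hA₀
  have hA₀0 : 0 < A₀ := by positivity
  set ε : ℝ := δ / (3 * K * A₀) with hε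
  have hε0 : 0 < ε := by positivity
  set δ' : ℝ := δ * ε / (63 * K) with hδ'
  have hδ'0 : 0 < δ' := by positivity
  have hF : Tendsto (fun N : ℕ => localGibbsLaw σ a₀ u₀ θ₀ N (Φ N)
      {z | δ' < ∫ s in Icc 0 t, ∫ x,
        ((∑ j, ∑ k, Dst φ N ((Φ N).flow s z) x j k ^ 2) +
          ‖qfl φ N ((Φ N).flow s z) x‖ ^ 2)}) atTop (𝓝 0) :=
    hFMR Φ γ C φ hγ hγ' hadm t ht δ' hδ'0
  have hlim : Tendsto (fun N : ℕ =>
      localGibbsLaw σ a₀ u₀ θ₀ N (Φ N) {z | ∃ s ∈ Icc 0 t, ∃ x : UnitAddTorus (Fin 3),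
        Literature.MathematicalPhysics.KineticTheory.empiricalDensityField ((Φ N).flow s z)
          (fun y => φ N (y - x)) < c₁ ∨
        1 < Literature.MathematicalPhysics.KineticTheory.empiricalDensityField ((Φ N).flow s z)
          (fun y => φ N (y - x)) * σ ^ 3} +
      (localGibbsLaw σ a₀ u₀ θ₀ N (Φ N) {z | Cexp < ∫ s in Icc 0 t, ∫ y, Real.exp (lam * ‖y.2‖ ^ 2)
          ∂(empiricalMeasure ((Φ N).flow s z))} +
        localGibbsLaw σ a₀ u₀ θ₀ N (Φ N)
          {z | δ' < ∫ s in Icc 0 t, ∫ x,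
            ((∑ j, ∑ k, Dst φ N ((Φ N).flow s z) x j k ^ 2) +
              ‖qfl φ N ((Φ N).flow s z) x‖ ^ 2)})) atTop (𝓝 0) := by
    simpa using hWinT.add (hExpT.add hF)
  refine tendsto_of_tendsto_of_tendsto_of_le_of_le tendsto_const_nhds hlim (fun N => zero_le)
    fun N => ?_
  -- the union bound at fixed `N`
  have hφc : Continuous (φ N) := (hadm.1 N).continuous
  have hφ0 : ∀ y, 0 ≤ φ N y := hadm.2.1 N
  have hφ1 : ∫ y, φ N y = 1 := hadm.2.2.1 N
  have hφb : ∀ y, φ N y ≤ C * ((N : ℝ) + 1) ^ (3 * γ) := hadm.2.2.2.2.1 N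
  refine measure_le_of_imp3 _ (localGibbsLaw_compl_good' (Φ N)) fun z hz hzg hw hexp => ?_
  by_contra hfmr
  simp only [Set.mem_setOf_eq, not_exists, not_or, not_lt, not_and] at hw hexp hfmr hz
  obtain ⟨τ, hτ, hτδ⟩ := hz
  have hwin : ∀ s ∈ Icc 0 t, ∀ x, c₁ ≤ rhoB φ N ((Φ N).flow s z) x ∧
      rhoB φ N ((Φ N).flow s z) x * σ ^ 3 ≤ 1 := fun s hs x => hw s hs x
  have hKf := abs_Kfun_le Φ hzg hφc hφ0 hφ1 hφb hc₁ hε0 hCt0 hCZ0 hCZ hCtψ hCtχ hwin hτ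
  have hEn := energy_le_expMoment Φ hzg hlam ht.le
  set e := ((N + 1 : ℕ) : ℝ)⁻¹ * configEnergy z with he
  set I := ∫ s in Icc 0 t, ∫ x, ((∑ j, ∑ k, Dst φ N ((Φ N).flow s z) x j k ^ 2) +
    ‖qfl φ N ((Φ N).flow s z) x‖ ^ 2) with hI
  have hI0 : 0 ≤ I := integral_nonneg fun s => integral_nonneg fun x => by positivity
  have he0 : 0 ≤ e := mul_nonneg (by positivity) (by unfold configEnergy; positivity)
  have het : e * t ≤ |Cexp| / (2 * lam) := by
    rw [le_div_iff₀ (by positivity)]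
    nlinarith [hEn.trans (hexp.trans (le_abs_self Cexp))]
  have hKK : CZ * Ct ≤ K := by rw [hK]; linarith
  have h1 : (CZ * Ct * (12 * ε) + CZ * Ct * (24 * ε / c₁) * e) * t ≤ δ / 3 := by
    calc (CZ * Ct * (12 * ε) + CZ * Ct * (24 * ε / c₁) * e) * t
        = CZ * Ct * ε * (12 * t + 24 / c₁ * (e * t)) := by ring
      _ ≤ K * ε * (12 * t + 24 / c₁ * (|Cexp| / (2 * lam))) := by gcongr
      _ = K * ε * A₀ := by rw [hA₀]; field_simp; ring
      _ = δ / 3 := by rw [hε]; field_simp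
  have h2 : CZ * Ct * (21 / ε) * I ≤ δ / 3 := by
    calc CZ * Ct * (21 / ε) * I ≤ K * (21 / ε) * δ' := by gcongr
      _ = δ / 3 := by rw [hδ']; field_simp; ring
  linarith

end

end Summit.AtomisticToContinuum.HydrodynamicLimit.Theorems.HemisphereAffineSlaving
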